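import Literature.GroupTheory.CombinatorialGroupTheory.FreeFactorFibredTwist
import HarnessLib

/-!
# The cut-off character twist: separating covers for subgroups generated by basis letters and killed words

Topic `Literature/GroupTheory/CombinatorialGroupTheory`; theorems only, Mathlib-only; sibling of
`FreeFactorFibredTwist.lean` (abc-iut-f-166), whose FIBRED TWIST it simplifies and extends from free
factors `Γ_S = ⟨b(S)⟩` to subgroups `A = ⟨b(S) ∪ E⟩` generated by basis letters TOGETHER WITH extra words
`E` in the letters killed by a global character — the shape of the vertex groups of pointed stable curves
that are NOT free factors of `π₁`: a component carrying ALL the cusps of a two-component curve has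
`Π_v = ⟨a_i, b_i (i < g₀), c_0, …, c_r⟩ = ⟨b(S) ∪ {ε}⟩` with `ε = (∏_{i ≥ g₀} [a_i, b_i])⁻¹` the boundary of
the complementary handles ([CombGC] Prop. 1.2, proof p. 9, "gluing together appropriate finite étale
coverings of the anabelioids `G_v`, `G_e`" [cite: MochizukiCombGC2007, Prop 1.2 proof p.9]; Serre, *Trees*,
I §5.5 Thm. 14 for the coset-graph picture [cite: SerreTrees1980, I §5.5 Thm. 14]).

**Setting.**  `Γ` free with basis `b : β → Γ`, `S ⊆ β`, `Φ : Γ → M` a character (`M` abelian) KILLING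
every letter outside `S`; `K₀ = ⟨b_i : i ∉ S or Φ(b_i) = 1⟩ ⊆ Ker Φ`; `E ⊆ K₀` any set of words;
`A = ⟨b(S) ∪ E⟩`; `N ⊴ Γ` any normal subgroup; `f ∈ Γ`.

**Theorem `exists_character_extension_of_cutoff`.**  There is a character `χ : N → M` with
`χ(f x f⁻¹) = Φ(x)` for `x ∈ A ∩ N` and `χ(g x g⁻¹) = 1` for `x ∈ A ∩ N` whenever `f⁻¹ g ∉ A·N`.
Construction (the CUT-OFF CHARACTER TWIST).  `Q = Γ/N`, `Ā` the image of `A`,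
`O = {q : q·π(f) ∈ Ā}` (an `A`-stable subset).  On `X = Q × M` let a letter `b_i`, `i ∈ S`, act by
`(q, m) ↦ (b_i q, m · Φ(b_i)^{[q ∈ O]})` and every other letter by plain translation `(q, m) ↦ (b_i q, m)`;
the basis being free this is a `Γ`-action `ρ`.  The cut-off action `T(a)(q, m) = (a q, m · Φ(a)^{[q ∈ O]})`
is an `A`-action (because `O` is `A`-stable) which agrees with `ρ` on `b(S)` and on `A ∩ K₀` (both are
plain there, `Φ` killing `K₀`), hence on `A`.  `ρ` covers left translation on `Q` and commutes with right
translation by `M`, so `χ(n) := pr₂(ρ(n)(1, 1))` is a homomorphism on `N` with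
`χ(g x g⁻¹) = Φ(x)^{[π(g⁻¹) ∈ O]}`, and `π(g⁻¹) ∈ O ⟺ f⁻¹ g ∈ A·N`.  Compared with the fibred twist no
section of the orbit and no cocycle bookkeeping is needed; the price is that the character of `A ∩ N` to
be extended must be the restriction of a global character killing the complementary letters — which is
exactly what finite-index levels supply (`b_{i₀}^{[Γ:N]} ∈ A ∩ N`).

**Corollary `exists_normal_separating_of_cutoff`** (the form consumed by [CombGC] Prop. 1.2, proof p. 9,
verticial separating covering at ONE vertex): for `N` of finite index, `Ψ : Γ → ℤ` killing the letters
outside `S` with `E ⊆ ⟨b_i : i ∉ S or Ψ(b_i) = 0⟩` and `Ψ(b_{i₀}) ≠ 0` for some letter `b_{i₀} ∈ A`, and a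
prime `ℓ`: there is `U ⊴ N` of index a power of `ℓ` with `f (A ∩ N) f⁻¹ ⊄ U` and `g (A ∩ N) g⁻¹ ⊆ U`
whenever `f⁻¹ g ∉ A·N` (reduce `Ψ` modulo `ℓⁿ > |[Γ:N]·Ψ(b_{i₀})|`).  Elementary; 0 definitions; nothing
here concerns [IUTchIII].
-/

namespace Literature.GroupTheory.CombinatorialGroupTheory

namespace FreeBasisCutoffCharacterTwist

open scoped Pointwise
open FreeFactorFibredTwist (lift_apply_basis mem_closure_range_basis normal_coe_mul_comm)

variable {Γ : Type*} [Group Γ] {β : Type*}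

/-- A character kills the subgroup generated by the letters it kills. [cite: SerreTrees1980, I §5.5 Thm. 14] -/
theorem map_eq_one_of_mem_closure {M : Type*} [CommGroup M] (b : β → Γ) (Φ : Γ →* M) (T : Set β)
    (hT : ∀ i ∈ T, Φ (b i) = 1) {x : Γ} (hx : x ∈ Subgroup.closure (b '' T)) : Φ x = 1 := by
  rw [← MonoidHom.mem_ker]
  refine (Subgroup.closure_le Φ.ker).mpr ?_ hx
  rintro _ ⟨i, hi, rfl⟩
  exact hT i hi

/-- **The cut-off character twist.**  For a free group `Γ` with basis `b`, `S ⊆ β`, an abelian group `M`,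
a character `Φ : Γ → M` killing every letter outside `S`, a set of words `E` in the letters killed by `Φ`
(outside `S` or inside `S ∩ Ker Φ`), `A = ⟨b(S) ∪ E⟩`, a normal subgroup `N ⊴ Γ` and `f ∈ Γ`: there is a
character `χ : N → M` with `χ(f x f⁻¹) = Φ(x)` on `A ∩ N` and `χ(g x g⁻¹) = 1` for `x ∈ A ∩ N` whenever
`f⁻¹ g ∉ A · N`. [cite: SerreTrees1980, I §5.5 Thm. 14] -/
theorem exists_character_extension_of_cutoff (b : FreeGroupBasis β Γ) (S : Set β)
    {M : Type*} [CommGroup M] (Φ : Γ →* M) (hΦ : ∀ i, i ∉ S → Φ (b i) = 1)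
    (E : Set Γ) (hE : E ⊆ Subgroup.closure (b '' {i | i ∈ S → Φ (b i) = 1}))
    (A : Subgroup Γ) (hA : A = Subgroup.closure (b '' S ∪ E))
    (N : Subgroup Γ) [hN : N.Normal] (f : Γ) :
    ∃ χ : N →* M,
      (∀ (x : Γ) (hx : x ∈ A ⊓ N), χ ⟨f * x * f⁻¹, hN.conj_mem x hx.2 f⟩ = Φ x) ∧
      ∀ g : Γ, f⁻¹ * g ∉ (A : Set Γ) * (N : Set Γ) →
        ∀ (x : Γ) (hx : x ∈ A ⊓ N), χ ⟨g * x * g⁻¹, hN.conj_mem x hx.2 g⟩ = 1 := by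
  classical
  -- the quotient `Q = Γ/N`, the image `Ā` of `A`, the `A`-stable set `O`
  set π : Γ →* Γ ⧸ N := QuotientGroup.mk' N with hπ
  have hπN : ∀ {x : Γ}, π x = 1 ↔ x ∈ N := fun {x} => by
    rw [hπ, QuotientGroup.mk'_apply, QuotientGroup.eq_one_iff]
  set Abar : Subgroup (Γ ⧸ N) := A.map π with hAbar
  have hAN : ∀ {x : Γ}, π x ∈ Abar ↔ x ∈ (A : Set Γ) * (N : Set Γ) := fun {x} => by
    have hk : A ⊔ N = Abar.comap π := by
      rw [hAbar, Subgroup.comap_map_eq, hπ, QuotientGroup.ker_mk']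
    rw [← Subgroup.mul_normal A N, SetLike.mem_coe, hk, Subgroup.mem_comap]
  let O : Set (Γ ⧸ N) := {q | q * π f ∈ Abar}
  have hO_iff : ∀ q, q ∈ O ↔ q * π f ∈ Abar := fun q => Iff.rfl
  have hO_mul : ∀ {a : Γ}, a ∈ A → ∀ q, π a * q ∈ O ↔ q ∈ O := by
    intro a ha q
    rw [hO_iff, hO_iff, mul_assoc]
    exact Subgroup.mul_mem_cancel_left _ (Subgroup.mem_map_of_mem π ha)
  -- the cut-off character `c a q = Φ(a)` on `O`, `= 1` off `O`
  let c : Γ → Γ ⧸ N → M := fun a q => if q ∈ O then Φ a else 1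
  have hc_pos : ∀ {a : Γ} {q : Γ ⧸ N}, q ∈ O → c a q = Φ a := fun {a q} h => if_pos h
  have hc_neg : ∀ {a : Γ} {q : Γ ⧸ N}, q ∉ O → c a q = 1 := fun {a q} h => if_neg h
  have hc_cocycle : ∀ {a a' : Γ}, a' ∈ A → ∀ q, c (a * a') q = c a (π a' * q) * c a' q := by
    intro a a' ha' q
    by_cases hq : q ∈ O
    · rw [hc_pos hq, hc_pos ((hO_mul ha' q).mpr hq), hc_pos hq, map_mul]
    · rw [hc_neg hq, hc_neg (fun h => hq ((hO_mul ha' q).mp h)), hc_neg hq, mul_one]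
  have hc_ker : ∀ {a : Γ}, Φ a = 1 → ∀ q, c a q = 1 := fun {a} ha q => by
    by_cases hq : q ∈ O
    · rw [hc_pos hq, ha]
    · rw [hc_neg hq]
  -- the cut-off action `T` of `A` on `X = Q × M`
  let T : Γ → (Γ ⧸ N) × M → (Γ ⧸ N) × M := fun a x => (π a * x.1, x.2 * c a x.1)
  have hT : ∀ a q m₀, T a (q, m₀) = (π a * q, m₀ * c a q) := fun _ _ _ => rfl
  have hT_mul : ∀ {a a' : Γ}, a' ∈ A → ∀ x, T (a * a') x = T a (T a' x) := by
    rintro a a' ha' ⟨q, m₀⟩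
    change (π (a * a') * q, m₀ * c (a * a') q) = (π a * (π a' * q), m₀ * c a' q * c a (π a' * q))
    rw [map_mul, mul_assoc (π a) (π a') q, hc_cocycle ha', mul_assoc m₀,
      mul_comm (c a (π a' * q)) (c a' q)]
  have hT_one : ∀ x, T 1 x = x := by
    rintro ⟨q, m₀⟩
    rw [hT, map_one, one_mul, hc_ker (map_one Φ), mul_one]
  let perm : ∀ a : Γ, a ∈ A → Equiv.Perm ((Γ ⧸ N) × M) := fun a ha =>
    { toFun := T a
      invFun := T a⁻¹
      left_inv := fun x => by
        rw [← hT_mul ha, inv_mul_cancel, hT_one]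
      right_inv := fun x => by
        rw [← hT_mul (A.inv_mem ha), mul_inv_cancel, hT_one] }
  have hperm : ∀ {a} (ha : a ∈ A) x, perm a ha x = T a x := fun _ _ => rfl
  -- plain translation, as a homomorphism `Γ → Perm(Q × M)`
  let plainHom : Γ →* Equiv.Perm ((Γ ⧸ N) × M) :=
    { toFun := fun g => (Equiv.mulLeft (π g)).prodCongr (Equiv.refl M)
      map_one' := Equiv.ext fun x => Prod.ext (by simp) (by simp)
      map_mul' := fun g g' => Equiv.ext fun x => Prod.ext (by simp [mul_assoc]) (by simp) }
  let plain : Γ → Equiv.Perm ((Γ ⧸ N) × M) := fun g => plainHom g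
  have hplain : ∀ g q m₀, plain g (q, m₀) = (π g * q, m₀) := fun _ _ _ => rfl
  have hT_plain : ∀ {a : Γ}, Φ a = 1 → ∀ x, T a x = plain a x := by
    rintro a ha ⟨q, m₀⟩
    rw [hT, hplain, hc_ker ha, mul_one]
  -- the `Γ`-action, basis letter by basis letter (free: no relation to check)
  have hbS : ∀ {i}, i ∈ S → b i ∈ A := fun {i} hi => by
    rw [hA]; exact Subgroup.subset_closure (Or.inl (Set.mem_image_of_mem b hi))
  let ρ : Γ →* Equiv.Perm ((Γ ⧸ N) × M) :=
    b.lift fun i => if hi : i ∈ S then perm (b i) (hbS hi) else plain (b i)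
  have hρ_basis : ∀ i, ρ (b i) = if hi : i ∈ S then perm (b i) (hbS hi) else plain (b i) :=
    fun i => lift_apply_basis b _ i
  -- (0) on `K₀ = ⟨b_i : i ∉ S ∨ Φ(b_i) = 1⟩`, `ρ` is plain
  have hρ_plain_le : Subgroup.closure (b '' {i | i ∈ S → Φ (b i) = 1}) ≤ ρ.eqLocus plainHom := by
    rw [Subgroup.closure_le]
    rintro _ ⟨i, hi, rfl⟩
    change ρ (b i) = plainHom (b i)
    by_cases hiS : i ∈ S
    · rw [hρ_basis i, dif_pos hiS]
      exact Equiv.ext fun x => hT_plain (hi hiS) x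
    · rw [hρ_basis i, dif_neg hiS]
  have hρ_plain : ∀ (x : Γ), x ∈ Subgroup.closure (b '' {i | i ∈ S → Φ (b i) = 1}) →
      ∀ y, ρ x y = plain x y := by
    intro x hx y
    have h : ρ x = plainHom x := hρ_plain_le hx
    rw [h]
  -- (1) on `A`, `ρ` is the cut-off action
  have hΦK₀ : ∀ {x : Γ}, x ∈ Subgroup.closure (b '' {i | i ∈ S → Φ (b i) = 1}) → Φ x = 1 :=
    fun {x} hx => map_eq_one_of_mem_closure b Φ {i | i ∈ S → Φ (b i) = 1}
      (fun i hi => by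
        by_cases hiS : i ∈ S
        · exact hi hiS
        · exact hΦ i hiS) hx
  have hρA : ∀ (a : Γ) (ha : a ∈ A) (x : (Γ ⧸ N) × M), ρ a x = T a x := by
    have hmemA : ∀ {a}, a ∈ Subgroup.closure (b '' S ∪ E) → a ∈ A := fun h => by rw [hA]; exact h
    intro a ha
    have ha' : a ∈ Subgroup.closure (b '' S ∪ E) := by rw [← hA]; exact ha
    refine Subgroup.closure_induction (p := fun a _ => ∀ x, ρ a x = T a x) ?_ ?_ ?_ ?_ ha'
    · rintro y (⟨i, hi, rfl⟩ | hy) x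
      · rw [hρ_basis i, dif_pos hi, hperm (hbS hi)]
      · rw [hρ_plain y (hE hy) x, hT_plain (hΦK₀ (hE hy))]
    · intro x
      rw [map_one, hT_one, Equiv.Perm.one_apply]
    · intro a a' ha ha' iha iha' x
      rw [map_mul, Equiv.Perm.mul_apply, iha', iha, hT_mul (hmemA ha')]
    · intro a ha iha x
      have h := iha (ρ a⁻¹ x)
      rw [← Equiv.Perm.mul_apply, ← map_mul, mul_inv_cancel, map_one, Equiv.Perm.one_apply] at h
      calc ρ a⁻¹ x = T a⁻¹ (T a (ρ a⁻¹ x)) := by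
              rw [← hT_mul (hmemA ha), inv_mul_cancel, hT_one]
        _ = T a⁻¹ x := by rw [← h]
  -- (2) `ρ` covers left translation on `Q`; (3) `ρ` commutes with right translation by `M`
  have hρ_fst_snd : ∀ g : Γ, (∀ (q : Γ ⧸ N) (m₀ : M), (ρ g (q, m₀)).1 = π g * q) ∧
      ∀ (q : Γ ⧸ N) (m₀ m : M), ρ g (q, m₀ * m) = ((ρ g (q, m₀)).1, (ρ g (q, m₀)).2 * m) := by
    intro g
    refine Subgroup.closure_induction (p := fun g _ => (∀ (q : Γ ⧸ N) (m₀ : M),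
        (ρ g (q, m₀)).1 = π g * q) ∧
      ∀ (q : Γ ⧸ N) (m₀ m : M), ρ g (q, m₀ * m) = ((ρ g (q, m₀)).1, (ρ g (q, m₀)).2 * m))
      ?_ ?_ ?_ ?_ (mem_closure_range_basis b g)
    · rintro _ ⟨i, rfl⟩
      by_cases hi : i ∈ S
      · refine ⟨fun q m₀ => ?_, fun q m₀ m => ?_⟩
        · rw [hρ_basis i, dif_pos hi, hperm (hbS hi), hT]
        · rw [hρ_basis i, dif_pos hi, hperm (hbS hi), hperm (hbS hi), hT, hT, mul_right_comm]
      · refine ⟨fun q m₀ => ?_, fun q m₀ m => ?_⟩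
        · rw [hρ_basis i, dif_neg hi, hplain]
        · rw [hρ_basis i, dif_neg hi, hplain, hplain]
    · refine ⟨fun q m₀ => ?_, fun q m₀ m => ?_⟩
      · rw [map_one, Equiv.Perm.one_apply, map_one, one_mul]
      · rw [map_one, Equiv.Perm.one_apply, Equiv.Perm.one_apply]
    · rintro g g' - - ⟨ih₁, ih₂⟩ ⟨ih₁', ih₂'⟩
      refine ⟨fun q m₀ => ?_, fun q m₀ m => ?_⟩
      · rw [map_mul, Equiv.Perm.mul_apply, map_mul, mul_assoc, ← ih₁' q m₀]
        obtain ⟨q', m'⟩ := ρ g' (q, m₀)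
        exact ih₁ q' m'
      · rw [map_mul, Equiv.Perm.mul_apply, Equiv.Perm.mul_apply, ih₂']
        obtain ⟨q', m'⟩ := ρ g' (q, m₀)
        exact ih₂ q' m' m
    · rintro g - ⟨ih₁, ih₂⟩
      have hinv : ∀ (q : Γ ⧸ N) (m₀ : M), ρ g (ρ g⁻¹ (q, m₀)) = (q, m₀) := fun q m₀ => by
        rw [← Equiv.Perm.mul_apply, ← map_mul, mul_inv_cancel, map_one, Equiv.Perm.one_apply]
      refine ⟨fun q m₀ => ?_, fun q m₀ m => ?_⟩
      · have h1 := ih₁ (ρ g⁻¹ (q, m₀)).1 (ρ g⁻¹ (q, m₀)).2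
        rw [Prod.mk.eta, hinv] at h1
        rw [show π g⁻¹ = (π g)⁻¹ from map_inv π g, eq_inv_mul_iff_mul_eq]
        exact h1.symm
      · have h2 := ih₂ (ρ g⁻¹ (q, m₀)).1 (ρ g⁻¹ (q, m₀)).2 m
        rw [Prod.mk.eta, hinv] at h2
        have h3 := congrArg (ρ g⁻¹) h2
        rw [← Equiv.Perm.mul_apply, ← map_mul, inv_mul_cancel, map_one, Equiv.Perm.one_apply] at h3
        exact h3.symm
  have hρ_fst : ∀ (g : Γ) (q : Γ ⧸ N) (m₀ : M), (ρ g (q, m₀)).1 = π g * q :=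
    fun g => (hρ_fst_snd g).1
  have hρ_snd : ∀ (g : Γ) (q : Γ ⧸ N) (m₀ m : M),
      ρ g (q, m₀ * m) = ((ρ g (q, m₀)).1, (ρ g (q, m₀)).2 * m) := fun g => (hρ_fst_snd g).2
  -- elements of `N` fix the first coordinate
  have hρN : ∀ {n : Γ}, n ∈ N → ∀ (q : Γ ⧸ N) (m₀ : M), ρ n (q, m₀) = (q, (ρ n (q, m₀)).2) := by
    intro n hn q m₀
    exact Prod.ext (by rw [hρ_fst, hπN.mpr hn, one_mul]) rfl
  -- the character `χ(n) = pr₂ (ρ n (1, 1))`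
  let χ : N →* M :=
    { toFun := fun n => (ρ (n : Γ) ((1 : Γ ⧸ N), (1 : M))).2
      map_one' := by
        change (ρ ((1 : N) : Γ) ((1 : Γ ⧸ N), (1 : M))).2 = 1
        rw [OneMemClass.coe_one, map_one, Equiv.Perm.one_apply]
      map_mul' := fun n n' => by
        change (ρ ((n : Γ) * n') ((1 : Γ ⧸ N), (1 : M))).2 =
          (ρ (n : Γ) ((1 : Γ ⧸ N), (1 : M))).2 * (ρ (n' : Γ) ((1 : Γ ⧸ N), (1 : M))).2
        have e' : ρ (n' : Γ) ((1 : Γ ⧸ N), (1 : M)) = (1, (ρ (n' : Γ) ((1 : Γ ⧸ N), (1 : M))).2) :=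
          hρN n'.2 1 1
        have h := hρ_snd (n : Γ) 1 1 (ρ (n' : Γ) ((1 : Γ ⧸ N), (1 : M))).2
        rw [one_mul] at h
        rw [map_mul ρ, Equiv.Perm.mul_apply, e', h] }
  have hχ : ∀ (n : Γ) (hn : n ∈ N), χ ⟨n, hn⟩ = (ρ n ((1 : Γ ⧸ N), (1 : M))).2 := fun _ _ => rfl
  -- `χ (g x g⁻¹) = c x (π g⁻¹)` for `x ∈ A ∩ N`
  have hχ_conj : ∀ (g x : Γ) (hx : x ∈ A ⊓ N),
      χ ⟨g * x * g⁻¹, hN.conj_mem x hx.2 g⟩ = c x (π g⁻¹) := by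
    intro g x hx
    rw [hχ, map_mul ρ, map_mul ρ, Equiv.Perm.mul_apply, Equiv.Perm.mul_apply]
    set y := ρ g⁻¹ ((1 : Γ ⧸ N), (1 : M)) with hy
    have hy1 : y.1 = π g⁻¹ := by
      have h := hρ_fst g⁻¹ 1 1
      rw [← hy, mul_one] at h
      exact h
    have hxy : ρ x y = (y.1, y.2 * c x (π g⁻¹)) := by
      rw [hρA x hx.1]
      change (π x * y.1, y.2 * c x y.1) = (y.1, y.2 * c x (π g⁻¹))
      rw [hπN.mpr hx.2, one_mul, hy1]
    rw [hxy, hρ_snd g y.1 y.2, Prod.mk.eta, hy, ← Equiv.Perm.mul_apply, ← map_mul, mul_inv_cancel,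
      map_one, Equiv.Perm.one_apply]
    exact one_mul _
  refine ⟨χ, fun x hx => ?_, fun g hg x hx => ?_⟩
  · -- `χ (f x f⁻¹) = Φ x`: `π f⁻¹ ∈ O`
    rw [hχ_conj f x hx]
    have hfO : π f⁻¹ ∈ O := by
      rw [hO_iff, ← map_mul, inv_mul_cancel, map_one]
      exact one_mem _
    exact hc_pos hfO
  · -- `χ (g x g⁻¹) = 1` off the orbit of `π f⁻¹`
    rw [hχ_conj g x hx]
    refine hc_neg fun hgO => hg ?_
    have h1 : π (g⁻¹ * f) ∈ Abar := by rw [map_mul]; exact hgO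
    obtain ⟨a, ha, n, hn, h⟩ := Set.mem_mul.mp (hAN.mp h1)
    rw [← normal_coe_mul_comm A N]
    refine Set.mem_mul.mpr ⟨n⁻¹, N.inv_mem hn, a⁻¹, A.inv_mem ha, ?_⟩
    rw [← mul_inv_rev, h, mul_inv_rev, inv_inv]

/-- `b_{i₀}^{[Γ:N]} ∈ A ∩ N` for a letter `b_{i₀} ∈ A` and `N` of finite index. [cite: SerreTrees1980, I §5.5 Thm. 14] -/
theorem pow_index_mem_inf (A N : Subgroup Γ) [N.Normal] {x : Γ} (hx : x ∈ A) : x ^ N.index ∈ A ⊓ N :=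
  Subgroup.mem_inf.mpr ⟨A.pow_mem hx _, Subgroup.pow_index_mem N x⟩

/-- **Separating normal subgroup of prime-power index** ([CombGC] Prop. 1.2, proof p. 9, the verticial
separating covering at ONE vertex, discrete form, for vertex groups `A = ⟨b(S) ∪ E⟩` that need not be free
factors).  `Γ` free with basis `b`, `S ⊆ β`, `Ψ : Γ → ℤ` a character killing the letters outside `S`,
`E` a set of words in letters killed by `Ψ`, `A = ⟨b(S) ∪ E⟩` containing a letter `b_{i₀}` with
`Ψ(b_{i₀}) ≠ 0`, `N ⊴ Γ` of finite index, `ℓ` prime, `f ∈ Γ`: there is `U ⊴ N` of index a power of `ℓ` with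
`f (A ∩ N) f⁻¹ ⊄ U` and `g (A ∩ N) g⁻¹ ⊆ U` for every `g` with `f⁻¹ g ∉ A·N`.
[cite: MochizukiCombGC2007, Prop 1.2 proof p.9] -/
theorem exists_normal_separating_of_cutoff (b : FreeGroupBasis β Γ) (S : Set β)
    (Ψ : Γ →* Multiplicative ℤ) (hΨ : ∀ i, i ∉ S → Ψ (b i) = 1)
    (E : Set Γ) (hE : E ⊆ Subgroup.closure (b '' {i | i ∈ S → Ψ (b i) = 1}))
    (A : Subgroup Γ) (hA : A = Subgroup.closure (b '' S ∪ E))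
    {i₀ : β} (hi₀ : i₀ ∈ S) (hΨi₀ : Ψ (b i₀) ≠ 1)
    (N : Subgroup Γ) [hN : N.Normal] [hfi : N.FiniteIndex] {ℓ : ℕ} (hℓ : ℓ.Prime) (f : Γ) :
    ∃ U : Subgroup N, U.Normal ∧ (∃ k : ℕ, U.index = ℓ ^ k) ∧
      ¬ (ConjAct.toConjAct f • (A ⊓ N) ≤ U.map N.subtype) ∧
      ∀ g : Γ, f⁻¹ * g ∉ (A : Set Γ) * (N : Set Γ) →
        ConjAct.toConjAct g • (A ⊓ N) ≤ U.map N.subtype := by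
  classical
  -- the witness `y = b_{i₀}^{[Γ:N]} ∈ A ∩ N`, `Ψ(y) = [Γ:N] · Ψ(b_{i₀}) ≠ 0`
  have hbA : b i₀ ∈ A := by
    rw [hA]; exact Subgroup.subset_closure (Or.inl (Set.mem_image_of_mem b hi₀))
  set y : Γ := b i₀ ^ N.index with hy
  have hyAN : y ∈ A ⊓ N := pow_index_mem_inf A N hbA
  set t₀ : ℤ := Multiplicative.toAdd (Ψ (b i₀)) with ht₀
  have ht₀ne : t₀ ≠ 0 := fun h => hΨi₀ (by rw [← ofAdd_toAdd (Ψ (b i₀)), ← ht₀, h, ofAdd_zero])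
  set t : ℤ := (N.index : ℤ) * t₀ with htdef
  have htne : t ≠ 0 := mul_ne_zero (Nat.cast_ne_zero.mpr hfi.index_ne_zero) ht₀ne
  have hΨy : Multiplicative.toAdd (Ψ y) = t := by
    rw [hy, map_pow, toAdd_pow, ← ht₀, nsmul_eq_mul]
  -- reduce modulo `ℓⁿ > |t|`
  set n : ℕ := t.natAbs with hn
  haveI : NeZero (ℓ ^ n) := ⟨pow_ne_zero n hℓ.ne_zero⟩
  have htmod : ((t : ℤ) : ZMod (ℓ ^ n)) ≠ 0 := by
    intro h
    rw [ZMod.intCast_zmod_eq_zero_iff_dvd] at h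
    refine htne (Int.eq_zero_of_dvd_of_natAbs_lt_natAbs h ?_)
    rw [← hn, Int.natAbs_natCast]
    exact Nat.lt_pow_self hℓ.one_lt
  let Φ : Γ →* Multiplicative (ZMod (ℓ ^ n)) :=
    (AddMonoidHom.toMultiplicative (Int.castAddHom (ZMod (ℓ ^ n)))).comp Ψ
  have hΦapply : ∀ x, Φ x = Multiplicative.ofAdd ((Multiplicative.toAdd (Ψ x) : ℤ) : ZMod (ℓ ^ n)) :=
    fun x => rfl
  have hΦ_of : ∀ {x : Γ}, Ψ x = 1 → Φ x = 1 := fun {x} hx => by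
    rw [hΦapply, hx, toAdd_one, Int.cast_zero, ofAdd_zero]
  have hΦ : ∀ i, i ∉ S → Φ (b i) = 1 := fun i hi => hΦ_of (hΨ i hi)
  have hE' : E ⊆ Subgroup.closure (b '' {i | i ∈ S → Φ (b i) = 1}) :=
    hE.trans (Subgroup.closure_mono (Set.image_mono fun i hi hiS => hΦ_of (hi hiS)))
  have hΦy : Φ y ≠ 1 := by
    rw [hΦapply, hΨy]
    intro h
    exact htmod (Multiplicative.ofAdd.injective (h.trans ofAdd_zero.symm))
  obtain ⟨χ, hχf, hχg⟩ := exists_character_extension_of_cutoff b S Φ hΦ E hE' A hA N f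
  have hyf : χ ⟨f * y * f⁻¹, hN.conj_mem _ hyAN.2 f⟩ = Φ y := hχf y hyAN
  refine ⟨χ.ker, inferInstance, ?_, ?_, ?_⟩
  · -- the index is a power of `ℓ`: `N / Ker χ` embeds in `ℤ/ℓⁿ`
    have hcard : Nat.card (Multiplicative (ZMod (ℓ ^ n))) = ℓ ^ n := Nat.card_zmod (ℓ ^ n)
    have hdvd : χ.ker.index ∣ ℓ ^ n := by
      rw [Subgroup.index_ker]
      have h := Subgroup.card_subgroup_dvd_card χ.range
      rwa [hcard] at h
    obtain ⟨k, -, hk⟩ := (Nat.dvd_prime_pow hℓ).mp hdvd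
    exact ⟨k, hk⟩
  · -- nontrivial over the vertex of `f`
    intro hle
    apply hΦy
    have hm : ConjAct.toConjAct f • y ∈ ConjAct.toConjAct f • (A ⊓ N) :=
      Subgroup.smul_mem_pointwise_smul _ _ _ hyAN
    rw [ConjAct.smul_def, ConjAct.ofConjAct_toConjAct] at hm
    obtain ⟨u, hu, hu'⟩ := Subgroup.mem_map.mp (hle hm)
    have hu'' : u = ⟨f * y * f⁻¹, hN.conj_mem _ hyAN.2 f⟩ := Subtype.ext hu'
    rw [← hyf, ← hu'']
    exact hu
  · -- trivial over every other vertex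
    intro g hg z hz
    obtain ⟨x, hxB, rfl⟩ := (Subgroup.mem_smul_pointwise_iff_exists _ _ _).mp hz
    rw [ConjAct.smul_def, ConjAct.ofConjAct_toConjAct]
    exact Subgroup.mem_map.mpr ⟨⟨g * x * g⁻¹, hN.conj_mem x hxB.2 g⟩, hχg g hg x hxB, rfl⟩

end FreeBasisCutoffCharacterTwist

end Literature.GroupTheory.CombinatorialGroupTheory
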